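import Summits.BirchSwinnertonDyer.BirchSwinnertonDyer.Theorems.AlignedTransportAtTwoMainConjectureOfRankZeroBSDAtTwoCubicClassNumberParityOfLValue
import Summits.BirchSwinnertonDyer.BirchSwinnertonDyer.Theorems.AlignedTransportAtTwoOffStratumPartitionTwistFamilySmallSeeds
import Summits.BirchSwinnertonDyer.BirchSwinnertonDyer.Theorems.AlignedTransportAtTwoOffStratumRow2045b
import HarnessLib

/-!
# Route `AlignedTransportAtTwo`, crux C2 `MainConjectureOfRankZeroBSDAtTwo` (stmt-BirchSwinnertonDyer-22298):
# THE ROW AT `2045b1` — `h(ℚ(β))` IS EVEN, granted Creutz–Miller's `BSD(2045b1)` and the two-sided Brumer–Kramer / Yoo–Yu bound,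
# from two finite data: `∏_v c_v(2045b1)` odd (table: `1`) and `ord₂(L(2045b1,1)/Ω) ≠ 0` (table: `4`, `#Ш_an = 16`)

HONEST FRAMING (cell `bsd-f1-sign2`, WIDTH-5 attached prover seat `bsd-line-att-p5` gen 30 on line `birth` of the lead `bsd-line-att-p2`;
`--supports` stmt-BirchSwinnertonDyer-22298, closes nothing; BSD is NOT proved by any of this; the crux C2, its verdict «blocked-on
`Rank1Residual.GreenbergMuConjectureIrreducible`» and every registered stub are untouched). THEOREMS ONLY. The prediction of att-p5 g29
(«`2045b1` has `#Ш_an = 16` ⟹ `2 ∣ h(ℚ(u))`, so its `(0,1)` CLASS-NUMBER rows can never fire») as a theorem: PRINT {Creutz–Miller 2012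
Thm. 1.1 (`hCM`, `N = 2045 < 5000`), GZK (`hGZK`), Yoo–Yu 2022 Thm. 1.6 two-sided (`hYY2`)} + the seed's `r_an = 0` + TWO FINITE DATA of the X5
table (`tam = 1`, `v₂(L/Ω) = 4`; displayed as `Odd (∏ c_v)` and `ord₂ q ≠ 0`) ⟹ `2 ∣ #Cl(ℚ(β))` for every root `β` of the `2`-division cubic of
`2045b1`. Tree inputs: `goodOrd_two_2045b1`, `not_hasRationalTwoTorsionX_2045b1`, `Δ_2045b1_neg`, `bsdp_two_2045b1_of_creutzMiller`, and
`…CubicClassNumberParityOfLValue.two_dvd_card_classGroup_adjoin_of_bsdp_of_padicValRat_lValue_ne_zero` (this gen). Consequence for the lineage: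
at `2045b1` the cubic road is the RANK form (g25/g28 `…_of_rankCert_…`) or a layer pair `(n, n+1)` with `n ≥ 1`, never the class-number form at
`(0,1)`. CONDITIONAL (three PRINT facts + data displayed); nothing is asserted unconditionally about `2045b1`; nothing closed; BSD is not proved.

References: [CreutzMiller2012] Thm. 1.1; [YooYu2022] Thm. 1.6 with 1.4 / 1.10 / 1.11 (1), Remark 2.4; [Miller2011LMS] Def. 1.1;
[SilvermanAEC2009] Thm. X.4.2, X.4.14; [CremonaAlgorithms1997] Table 1 (`2045b1`); cell table X5-AT2-TABLE v1.2 (row `2045b`).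
-/

set_option linter.dupNamespace false
set_option autoImplicit false

noncomputable section

open scoped Classical NumberField IntermediateField

namespace Summit.BirchSwinnertonDyer.BirchSwinnertonDyer.Theorems.AlignedTransportAtTwoCubicClassNumberParityRow2045b1

open WeierstrassCurve NumberField Polynomial IntermediateField Literature.NumberTheory.EllipticCurves
  Literature.NumberTheory.EllipticCurves.Rank1Residual Literature.NumberTheory.EllipticCurves.Greenberg1999
  Literature.NumberTheory.EllipticCurves.Zhai2016
  Summit.BirchSwinnertonDyer.BirchSwinnertonDyer.Theorems.TowerClass
  Summit.BirchSwinnertonDyer.BirchSwinnertonDyer.Theorems.AlignedTransportAtTwoOffStratumRow2045b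
  Summit.BirchSwinnertonDyer.BirchSwinnertonDyer.Theorems.AlignedTransportAtTwoTwistFamilySmallSeeds
  Summit.BirchSwinnertonDyer.BirchSwinnertonDyer.Theorems.AlignedTransportAtTwoCubicClassNumberParityOfLValue
  Summit.BirchSwinnertonDyer.BirchSwinnertonDyer.Theorems.AlignedTransportAtTwoSelmerTwoOfBSDp

/-- **THE ROW AT `2045b1`: EVEN CLASS NUMBER OF THE CUBIC `2`-TORSION FIELD.** Granted Creutz–Miller (`hCM`: BSD for `r_an ≤ 1`, `N < 5000`),
GZK (`hGZK`) and Yoo–Yu's two-sided bound (`hYY2`), with the seed's `r_an(2045b1) = 0` and the two table data `Odd (∏_v c_v)` (`tam = 1`) and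
`L(2045b1,1)/Ω = q`, `ord₂ q ≠ 0` (`v₂ = 4`): `2 ∣ #Cl(ℚ(β))` for every root `β ∈ ℚ̄` of the `2`-division cubic of `2045b1`.
[cite: CreutzMiller2012, Thm. 1.1] [cite: YooYu2022, Thm. 1.6 with Thm. 1.4 / 1.10 / 1.11 (1)] [cite: Miller2011LMS, Def. 1.1]
[cite: SilvermanAEC2009, Thm. X.4.2 and X.4.14] -/
theorem two_dvd_card_classGroup_cubicField_2045b1 (hYY2 : yooYu_card_selmerTwo_bounds_cubicTwoTorsionField)
    (hCM : bsdTriple_of_rank_le_one_of_conductor_lt) (hGZK : rank_eq_analyticRank_of_analyticRank_le_one)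
    (hr0 : c2045b1.analyticRank = 0) (htam : Odd c2045b1.tamagawaProduct) {q : ℚ}
    (hL : c2045b1.entireLFunction 1 / (c2045b1.realPeriodRat : ℂ) = (q : ℂ)) (hv : padicValRat 2 q ≠ 0)
    {β : AlgebraicClosure ℚ} (hβ : aeval β c2045b1.twoTorsionPolynomial.toPoly = 0) :
    2 ∣ Nat.card (ClassGroup (𝓞 ↥(IntermediateField.adjoin ℚ ({β} : Set (AlgebraicClosure ℚ))))) :=
  two_dvd_card_classGroup_adjoin_of_bsdp_of_padicValRat_lValue_ne_zero c2045b1 hYY2 goodOrd_two_2045b1 not_hasRationalTwoTorsionX_2045b1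
    Δ_2045b1_neg htam hr0 (bsdp_two_2045b1_of_creutzMiller hCM hGZK hr0) hL hv hβ

/-- **The same row in Zhai's currency** (`IsLAlg`: `L(2045b1,1) = x · Ω_∞`, `Ω_∞ = Ω` since `Δ < 0`; table column `v₂(L/Ω_∞) = 4 ≠ 0`).
[cite: Zhai2016, §1] [cite: CreutzMiller2012, Thm. 1.1] [cite: YooYu2022, Thm. 1.6 with Thm. 1.4 / 1.10 / 1.11 (1)] [cite: Miller2011LMS, Def. 1.1] -/
theorem two_dvd_card_classGroup_cubicField_2045b1_of_isLAlg (hYY2 : yooYu_card_selmerTwo_bounds_cubicTwoTorsionField)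
    (hCM : bsdTriple_of_rank_le_one_of_conductor_lt) (hGZK : rank_eq_analyticRank_of_analyticRank_le_one)
    (hr0 : c2045b1.analyticRank = 0) (htam : Odd c2045b1.tamagawaProduct) {x : ℚ} (hx : IsLAlg c2045b1 x) (hv : padicValRat 2 x ≠ 0)
    {β : AlgebraicClosure ℚ} (hβ : aeval β c2045b1.twoTorsionPolynomial.toPoly = 0) :
    2 ∣ Nat.card (ClassGroup (𝓞 ↥(IntermediateField.adjoin ℚ ({β} : Set (AlgebraicClosure ℚ))))) :=
  two_dvd_card_classGroup_cubicField_2045b1 hYY2 hCM hGZK hr0 htam (lValue_div_realPeriodRat_eq_of_isLAlg_of_Δ_neg c2045b1 Δ_2045b1_neg hx)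
    hv hβ

/-- **The complementary reading at `2045b1`**: with the same PRINT inputs and `∏ c_v` odd, `Sel₂(2045b1/ℚ) = ⊥` would force `ord₂(L/Ω) = 0`
(`…SelmerTwoOfBSDp` §5) — so the table's `v₂(L/Ω) = 4` certifies `Sel₂(2045b1/ℚ) ≠ ⊥` (table: `dim Sel₂ = 2`), i.e. `Ш(2045b1)[2] ≠ 0` in rank `0`.
[cite: CreutzMiller2012, Thm. 1.1] [cite: Miller2011LMS, Def. 1.1] [cite: SilvermanAEC2009, Thm. X.4.2] -/
theorem selmerGroup_two_ne_bot_2045b1 (hCM : bsdTriple_of_rank_le_one_of_conductor_lt) (hGZK : rank_eq_analyticRank_of_analyticRank_le_one)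
    (hr0 : c2045b1.analyticRank = 0) (htam : Odd c2045b1.tamagawaProduct) {q : ℚ}
    (hL : c2045b1.entireLFunction 1 / (c2045b1.realPeriodRat : ℂ) = (q : ℂ)) (hv : padicValRat 2 q ≠ 0) :
    c2045b1.selmerGroup 2 ≠ ⊥ := fun hSel =>
  hv (padicValRat_lValue_eq_zero_of_bsdp_two_of_selmerGroup_eq_bot c2045b1 (bsdp_two_2045b1_of_creutzMiller hCM hGZK hr0) hr0
    not_hasRationalTwoTorsionX_2045b1 htam hSel hL)

end Summit.BirchSwinnertonDyer.BirchSwinnertonDyer.Theorems.AlignedTransportAtTwoCubicClassNumberParityRow2045b1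

end
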